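import Mathlib.Analysis.SpecialFunctions.Pow.Real
import Mathlib.Order.Filter.AtTopBot.Basic
import Mathlib.Topology.Order.Basic
import Literature.Computability.Complexity.CircuitRestriction
import Literature.Computability.Complexity.CliqueTestGraphs
import HarnessLib

/-!
# Rossman 2008: bounded-depth circuits are insensitive to a planted clique on `G(n, n^{-α})`

B. Rossman, *On the constant-depth complexity of k-clique*, STOC 2008, pp. 721–730
[Rossman2008], read from the author's copy (`math.toronto.edu/rossman/k-clique-stoc.pdf`,
§1.1 p. 2 for the statements, §5 p. 9 for the proofs, §6 for the open questions).

**WARNING — `rossman2008_thm11` is REFUTED as stated** (`not_rossman2008_thm11 :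
¬ rossman2008_thm11`, file `Rossman2008Refutation.lean` of this directory, 2026-08-15): the
printed range "`t > 1/2`, `0 < α ≤ 1/(2t-1)`" of Theorem 1.1 includes the corner `t < 3/4`,
`α ≥ 2`, where `ER(n, n^{-α})` is empty a.a.s. and the one-gate circuit `⋁ₑ xₑ` (depth `1`,
size `1`) notices a planted edge; the printed proof (§5) needs `α < 2` in its first display and
more besides (see that file's docstring). Consequently every theorem below and in
`Rossman2008CliqueProofs.lean` taking `(h : rossman2008_thm11)` is VACUOUS until a corrected
fact (restricted range of `(t, α)`, to be read from the full version / Rossman's thesis, MIT 2010,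
acquisition request acq-02439) replaces the hypothesis; the proofs of the reformulations only
pass `(t, α)` through and carry over once the corrected range hypotheses are added. Do not feed
`rossman2008_thm11` to anything new.

* **Theorem 1.1** (the main result, vendored as the NAMED FACT `rossman2008_thm11`): let
  `f_n : {0,1}^{C(n,2)} → {0,1}` be computed by `{¬, ∧, ∨}`-circuits (unbounded fan-in) of depth
  `O(1)` and size `O(n^t)`, `t > 1/2`; for constants `k ∈ ℕ` and `0 < α ≤ 1/(2t-1)` let
  `G = ER(n, n^{-α})` and let `A` be a uniform random `k`-subset of the vertices. Then
  `f_n(G) = f_n(G ∪ K_A)` asymptotically almost surely.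
* **Theorem 1.2** ("for every constant `k`, `k`-clique requires constant-depth circuits of size
  `ω(n^{k/4})`") is NOT a second fact: it is PROVED here from Theorem 1.1 exactly as on p. 9 of the
  paper (`rossman2008_thm12_of_thm11`, in `Rossman2008CliqueProofs.lean` of this directory once
  landed; this file carries the statement-level corollaries only).
* PROVED reformulations of Theorem 1.1 that provers can use directly:
  `rossman2008_thm11_uniform` — the same bound uniformly over all circuits of depth `≤ d` and
  size `≤ c₀ n^t` (a diagonal argument: the printed per-sequence statement applied to a worst
  circuit for each `n`), and `rossman2008_thm11_threshold` — its specialisation to the `k`-clique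
  threshold `q = n^{-2/(k-1)}` (`α = 2/(k-1) = 1/(2t-1)` for `t = (k+1)/4`, `k ≥ 2`): small
  bounded-depth circuits do not notice a planted `k`-clique in the CRITICAL random graph.

Probabilities are finite sums over edge vectors `x : E(K_n) → Bool` with the `G(n,q)` weights
`q^{e(x)} (1-q)^{C(n,2)-e(x)}` (`gnpWeight`), the vocabulary of route PneNP/OneSlice; planting is
`plantClique A x = x ∨ cliqueVec A` (definitionally the `plant` of
`Literature.Probability.RandomGraphs.PlantedClique`, which is not imported so that this topic stays
free of that file's cryptography imports — the same choice as `CliqueTestGraphs.lean`).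

## What this file does NOT say (route PneNP/OneSlice, item `SliceACZero`)

The hypothesis of `Summit.PneNP.PneNP.Theses.OneSlice.SliceACZero` — "∃ δ > 0: every depth-`d`
circuit with `G(n,q)`-error `≤ δ` against `k`-CLIQUE has `> n^c` gates, uniformly for all `q` with
`|q C(n,2) - m_k(n)| ≤ m_k(n)^{3/4}`" — is the folklore AVERAGE-CASE, SINGLE-THRESHOLD,
BOUNDED-ERROR strengthening that Rossman states in words in FOCS 2010 / SICOMP 2014 (§1, §9:
"[18] proves a lower bound of `ω(n^{k/4})` on the size of AC⁰ circuits that solve `k`-clique a.a.s.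
on `G(n,p)` for a single threshold function `p(n)`"). It is not a printed theorem of [Rossman2008]:
from `rossman2008_thm11_threshold` it needs in addition (i) contiguity of the planted model
`G(n,p) ∪ K_A` with `G(n,p)` at the threshold (the planted law is the clique-count size-biasing of
`G(n,p)`; Poisson first/second moments of `#K_k` give `Pr[no k-clique] → e^{-1/k!} > 0` and the
bounded-error transfer), and (ii) the printed Theorem 1.1 has a CONSTANT exponent `α`, i.e. exactly
`q = n^{-α}`, not all `q = p(1 + o(1))` in a window. Both are left to the route (or to the thesis
version: B. Rossman, *Average-case complexity of detecting cliques*, MIT 2010, acquisition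
request acq-02439).

## Modelling notes

* Depth is `Circuit.acDepth` (negations free, `ConstantDepth.lean`), Rossman counts every gate on
  a path; since double negations can be removed without cost, "depth `O(1)`" defines the same
  class of circuit sequences in both measures, and both theorems quantify over all constant
  depths. Size is the number of gates in both (`Circuit.size`; `¬`-gates count, as in the paper).
* "`f_n` computed by circuits of depth `O(1)` and size `O(n^t)`" is rendered as: a sequence of
  circuits `C n` with, eventually, `acDepth (C n) ≤ d` and `size (C n) ≤ c₀ · n^t` (real power),
  for some constants `d`, `c₀` — universally quantified outside.
* Degenerate parameters make `rossman2008_thm11` trivially true, never false: for `k ≤ 1` or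
  `k > n` planting changes nothing / the average over `k`-sets is empty (`plantFlipProb = 0`);
  `(0 : ℝ) ^ (-α) = 0` at `n = 0` is irrelevant to a limit.

## References

* [Rossman2008] B. Rossman, On the constant-depth complexity of k-clique, STOC 2008, 721–730,
  doi:10.1145/1374376.1374480 — Thm. 1.1, Thm. 1.2 (§1.1), proofs §5, open questions §6.
* B. Rossman, The monotone complexity of k-clique on random graphs, FOCS 2010 / SIAM J. Comput.
  43 (2014), §1 p. 2 and §9 (the single-threshold average-case reading of [Rossman2008]).
* K. Amano, k-Subgraph isomorphism on AC⁰ circuits, CCC 2009 / Comput. Complexity 19 (2010), §3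
  Thm. 1 (restates Thm. 1.1 as `α(t) ≥ 1/(2t-1)`) and Thm. 2 (size `n^{k/4+O(1)}` suffices).
-/

noncomputable section

namespace Literature.Computability.Complexity

open Finset Filter
open scoped _root_.Topology

/-! ### `G(n, q)` as a finite weighted sum over edge vectors; planting a clique -/

/-- `e(x)`: the number of edges switched on in the edge vector `x` of a graph on `Fin n`.
[folklore] -/
def edgeCount {n : ℕ} (x : (⊤ : SimpleGraph (Fin n)).edgeSet → Bool) : ℕ :=
  #(univ.filter fun e => x e = true)

/-- The `G(n, q)` (Erdős–Rényi, `ER(n, q)` in Rossman's notation) probability of the single edge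
vector `x`: `q^{e(x)} (1 - q)^{C(n,2) - e(x)}` — each of the `C(n,2)` potential edges is present
independently with probability `q` (Rossman 2008, §2 "Random Graphs"). Meaningful for
`0 ≤ q ≤ 1`. [cite: Rossman2008, §2 (Random Graphs)] -/
def gnpWeight (n : ℕ) (q : ℝ) (x : (⊤ : SimpleGraph (Fin n)).edgeSet → Bool) : ℝ :=
  q ^ edgeCount x * (1 - q) ^ (n.choose 2 - edgeCount x)

/-- Planting a clique: `G ∪ K_A`, i.e. every edge inside `A` is switched on and all other edge
indicators are kept (Rossman 2008, §2 "Graphs": "the union graph `G ∪ K_A` (i.e., `G` plus a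
clique on `A`)"). Definitionally `x e || cliqueVec A e`, the same function as
`Literature.Probability.RandomGraphs.PlantedClique.plant A x`. [cite: Rossman2008, §2 (Graphs)] -/
def plantClique {n : ℕ} (A : Finset (Fin n)) (x : (⊤ : SimpleGraph (Fin n)).edgeSet → Bool) :
    (⊤ : SimpleGraph (Fin n)).edgeSet → Bool :=
  fun e => x e || cliqueVec A e

/-- `Pr[f(G) ≠ f(G ∪ K_A)]` for `G ∼ G(n, q)` and, independently, `A` a uniformly random
`k`-element vertex set: the average over the `C(n,k)` sets `A` of the `G(n,q)`-mass of the edge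
vectors on which planting `K_A` flips `f` (Rossman 2008, Thm. 1.1: the event
"`f_n(G) = f_n(G ∪ K_A)`"). For `k > n` the average is over the empty family and the value is `0`
(documented junk, irrelevant eventually). [cite: Rossman2008, Thm. 1.1] -/
def plantFlipProb (n k : ℕ) (q : ℝ) (f : ((⊤ : SimpleGraph (Fin n)).edgeSet → Bool) → Bool) : ℝ :=
  ((n.choose k : ℕ) : ℝ)⁻¹ *
    ∑ A ∈ powersetCard k (univ : Finset (Fin n)),
      ∑ x : (⊤ : SimpleGraph (Fin n)).edgeSet → Bool,
        if f x = f (plantClique A x) then 0 else gnpWeight n q x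

/-- `Pr_{G ∼ G(n,q)}[f(G) ≠ g(G)]`: the `G(n,q)`-mass of the edge vectors where two Boolean graph
functions disagree (the average-case error of `f` against `g`; Rossman 2010/2014 §2: "`f` solves
`k`-clique a.a.s. on `G(n,p)` iff `Pr[f(G) ≠ (ω(G) ≥ k)] → 0`"). Written as the filtered sum used
verbatim by route PneNP/OneSlice. [folklore] -/
def gnpDisagreeProb (n : ℕ) (q : ℝ) (f g : ((⊤ : SimpleGraph (Fin n)).edgeSet → Bool) → Bool) : ℝ :=
  (univ.filter fun x : (⊤ : SimpleGraph (Fin n)).edgeSet → Bool => f x ≠ g x).sum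
    fun x => gnpWeight n q x

/-- `gnpDisagreeProb` unfolds to the inline expression of route PneNP/OneSlice
(`Σ_{x : f x ≠ g x} q^{#1(x)} (1-q)^{C(n,2) - #1(x)}`). [folklore] -/
theorem gnpDisagreeProb_eq (n : ℕ) (q : ℝ)
    (f g : ((⊤ : SimpleGraph (Fin n)).edgeSet → Bool) → Bool) :
    gnpDisagreeProb n q f g =
      (univ.filter fun x : (⊤ : SimpleGraph (Fin n)).edgeSet → Bool => f x ≠ g x).sum
        (fun x => q ^ (univ.filter fun e => x e = true).card *
          (1 - q) ^ (n.choose 2 - (univ.filter fun e => x e = true).card)) :=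
  rfl

/-- The `G(n,q)` weights are nonnegative for `0 ≤ q ≤ 1`. [folklore] -/
theorem gnpWeight_nonneg {n : ℕ} {q : ℝ} (hq0 : 0 ≤ q) (hq1 : q ≤ 1)
    (x : (⊤ : SimpleGraph (Fin n)).edgeSet → Bool) : 0 ≤ gnpWeight n q x :=
  mul_nonneg (pow_nonneg hq0 _) (pow_nonneg (sub_nonneg.2 hq1) _)

/-- `plantFlipProb` is nonnegative for `0 ≤ q ≤ 1`. [folklore] -/
theorem plantFlipProb_nonneg (n k : ℕ) {q : ℝ} (hq0 : 0 ≤ q) (hq1 : q ≤ 1)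
    (f : ((⊤ : SimpleGraph (Fin n)).edgeSet → Bool) → Bool) : 0 ≤ plantFlipProb n k q f := by
  unfold plantFlipProb
  refine mul_nonneg (inv_nonneg.2 (Nat.cast_nonneg _)) (sum_nonneg fun A _ => ?_)
  exact sum_nonneg fun x _ => by split_ifs <;> [exact le_rfl; exact gnpWeight_nonneg hq0 hq1 x]

/-- `plantFlipProb` depends on `f` only through its values: two circuits computing the same
function have the same flip probability. [folklore] -/
theorem plantFlipProb_congr {n k : ℕ} {q : ℝ}
    {f g : ((⊤ : SimpleGraph (Fin n)).edgeSet → Bool) → Bool} (hfg : ∀ x, f x = g x) :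
    plantFlipProb n k q f = plantFlipProb n k q g := by
  have : f = g := funext hfg
  rw [this]

/-- Planting on a set with fewer than two vertices does nothing (an edge has two distinct
endpoints). [folklore] -/
theorem plantClique_of_card_le_one {n : ℕ} {A : Finset (Fin n)} (hA : #A ≤ 1)
    (x : (⊤ : SimpleGraph (Fin n)).edgeSet → Bool) : plantClique A x = x := by
  funext e
  obtain ⟨e, he⟩ := e
  induction e using Sym2.ind with
  | h u v =>
    have huv : u ≠ v := by simpa using he
    have hc : cliqueVec A ⟨s(u, v), he⟩ = false := by
      simp only [cliqueVec, Sym2.mem_iff, forall_eq_or_imp, forall_eq, decide_eq_false_iff_not,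
        not_and]
      intro hu hv
      exact huv (Finset.card_le_one.1 hA u hu v hv)
    simp [plantClique, hc]

/-! ### Theorem 1.1 (named fact) -/

/-- **Rossman 2008, Theorem 1.1** (planted-clique insensitivity of bounded-depth circuits).
"Suppose `f_n : {0,1}^{C(n,2)} → {0,1}` is a sequence of functions computed by constant-depth
circuits of size `O(n^t)` where `t > 1/2`. For any constants `k ∈ ℕ` and `0 < α ≤ 1/(2t-1)`, let
`G = ER(n, n^{-α})` be an Erdős–Rényi random graph and let `A` be a uniform random set of `k`
vertices of `G`. Then `f_n(G) = f_n(G ∪ K_A)` asymptotically almost surely."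
Rendering: `f_n = (C n).eval` for circuits `C n` over `acBasis = {¬, ∧ₖ, ∨ₖ}` with, eventually,
`acDepth ≤ d` and `size ≤ c₀ n^t`; conclusion `Pr_{G,A}[f_n(G) ≠ f_n(G ∪ K_A)] → 0`
(`plantFlipProb`). Amano (CCC 2009, Thm. 1) restates it as `α(t) ≥ 1/(2t-1)`.
**REFUTED as stated** — `not_rossman2008_thm11` (`Rossman2008Refutation.lean`): false for
`t < 3/4`, `2 ≤ α ≤ 1/(2t-1)` (empty random graph vs. one `∨`-gate); kept unchanged only so that
the vacuous dependents still compile until the corrected fact lands (see the module docstring).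
[cite: Rossman2008, Thm. 1.1 (§1.1; proof §5)] -/
def rossman2008_thm11 : Prop :=
  ∀ (k d : ℕ) (t α c₀ : ℝ), 1 / 2 < t → 0 < α → α ≤ 1 / (2 * t - 1) →
    ∀ C : (n : ℕ) → Circuit ((⊤ : SimpleGraph (Fin n)).edgeSet),
      (∀ᶠ n : ℕ in atTop, (C n).IsOver acBasis ∧ (C n).acDepth ≤ d ∧
          ((C n).size : ℝ) ≤ c₀ * (n : ℝ) ^ t) →
        Tendsto (fun n : ℕ => plantFlipProb n k ((n : ℝ) ^ (-α)) (C n).eval) atTop (𝓝 0)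

/-! ### Proved reformulations -/

/-- **Theorem 1.1, uniform form** (proved from the printed per-sequence statement): for all
constants `k, d, t > 1/2, 0 < α ≤ 1/(2t-1), c₀` and every `ε > 0`, for all large `n` EVERY circuit
over `{¬, ∧, ∨}` of `acDepth ≤ d` and size `≤ c₀ n^t` satisfies
`Pr_{G ∼ ER(n,n^{-α}), A}[C(G) ≠ C(G ∪ K_A)] ≤ ε`. Proof: otherwise pick, for the infinitely many
bad `n`, a bad circuit, and the one-gate constant circuit elsewhere; this sequence has depth
`≤ max d 1` and size `≤ (max c₀ 0 + 1) n^t`, so the fact applies to it and contradicts badness.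
(Vacuous while its hypothesis `rossman2008_thm11` stands refuted — `not_rossman2008_thm11`; the
diagonal argument keeps `(t, α)` fixed and serves the corrected fact on its range verbatim.)
[cite: Rossman2008, Thm. 1.1] -/
theorem rossman2008_thm11_uniform (h : rossman2008_thm11) (k d : ℕ) (t α c₀ : ℝ)
    (ht : 1 / 2 < t) (hα : 0 < α) (hαt : α ≤ 1 / (2 * t - 1)) {ε : ℝ} (hε : 0 < ε) :
    ∀ᶠ n : ℕ in atTop, ∀ C : Circuit ((⊤ : SimpleGraph (Fin n)).edgeSet),
      C.IsOver acBasis → C.acDepth ≤ d → (C.size : ℝ) ≤ c₀ * (n : ℝ) ^ t →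
        plantFlipProb n k ((n : ℝ) ^ (-α)) C.eval ≤ ε := by
  classical
  by_contra hnot
  -- the bad circuits
  let Bad : (n : ℕ) → Circuit ((⊤ : SimpleGraph (Fin n)).edgeSet) → Prop := fun n C =>
    C.IsOver acBasis ∧ C.acDepth ≤ d ∧ (C.size : ℝ) ≤ c₀ * (n : ℝ) ^ t ∧
      ε < plantFlipProb n k ((n : ℝ) ^ (-α)) C.eval
  have hfreq : ∃ᶠ n : ℕ in atTop, ∃ C, Bad n C := by
    rw [not_eventually] at hnot
    refine hnot.mono fun n hn => ?_
    push Not at hn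
    obtain ⟨C, h1, h2, h3, h4⟩ := hn
    exact ⟨C, h1, h2, h3, h4⟩
  -- the diagonal sequence
  let D : (n : ℕ) → Circuit ((⊤ : SimpleGraph (Fin n)).edgeSet) := fun n =>
    if hn : ∃ C, Bad n C then hn.choose else Circuit.const _ false
  have hD : ∀ᶠ n : ℕ in atTop, (D n).IsOver acBasis ∧ (D n).acDepth ≤ max d 1 ∧
      ((D n).size : ℝ) ≤ (max c₀ 0 + 1) * (n : ℝ) ^ t := by
    filter_upwards [eventually_ge_atTop 1] with n hn
    have hnt : 1 ≤ (n : ℝ) ^ t := Real.one_le_rpow (by exact_mod_cast hn) (by linarith)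
    have hnt0 : 0 ≤ (n : ℝ) ^ t := zero_le_one.trans hnt
    by_cases hex : ∃ C, Bad n C
    · have hB := hex.choose_spec
      simp only [D, dif_pos hex]
      refine ⟨hB.1, hB.2.1.trans (le_max_left _ _), hB.2.2.1.trans ?_⟩
      have : c₀ * (n : ℝ) ^ t ≤ max c₀ 0 * (n : ℝ) ^ t :=
        mul_le_mul_of_nonneg_right (le_max_left _ _) hnt0
      nlinarith [le_max_right c₀ 0]
    · simp only [D, dif_neg hex]
      refine ⟨Circuit.const_isOver_acBasis false, ?_, ?_⟩
      · rw [Circuit.acDepth_const]; exact le_max_right _ _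
      · rw [Circuit.size_const, Nat.cast_one]
        nlinarith [le_max_right c₀ 0]
  have hlim := h k (max d 1) t α (max c₀ 0 + 1) ht hα hαt D hD
  have hev : ∀ᶠ n : ℕ in atTop, plantFlipProb n k ((n : ℝ) ^ (-α)) (D n).eval < ε :=
    (tendsto_order.1 hlim).2 ε hε
  obtain ⟨n, ⟨C, hC⟩, hn⟩ := (hfreq.and_eventually hev).exists
  have hex : ∃ C, Bad n C := ⟨C, hC⟩
  have hB := hex.choose_spec
  have hDn : D n = hex.choose := by simp only [D, dif_pos hex]
  rw [hDn] at hn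
  exact (lt_irrefl _) (hB.2.2.2.trans hn)

/-- **Theorem 1.1 at the `k`-clique threshold** (proved specialisation): for `k ≥ 2` take
`t = (k+1)/4` and `α = 2/(k-1)`, so that `1/(2t-1) = 2/(k-1)` and `n^{-α} = n^{-2/(k-1)}` is the
threshold edge probability for `k`-cliques (`E[#K_k] → 1/k!`). Hence for every depth `d`,
constant `c₀` and `ε > 0`, for all large `n`, every `{¬,∧,∨}`-circuit of `acDepth ≤ d` and size
`≤ c₀ · n^{(k+1)/4}` has `Pr_{G ∼ G(n, n^{-2/(k-1)}), A}[C(G) ≠ C(G ∪ K_A)] ≤ ε` — small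
bounded-depth circuits are insensitive to a planted `k`-clique in the critical random graph
(the "single threshold" ingredient quoted by Rossman 2010/2014, §1). (Vacuous while its
hypothesis `rossman2008_thm11` stands refuted — `not_rossman2008_thm11`; its parameters
`t = (k+1)/4 > 1`, `α = 2/(k-1) < 1` for `k ≥ 4` lie outside the refuted corner.)
[cite: Rossman2008, Thm. 1.1 (with α = 2/(k-1), t = (k+1)/4)] -/
theorem rossman2008_thm11_threshold (h : rossman2008_thm11) {k : ℕ} (hk : 2 ≤ k) (d : ℕ)
    (c₀ : ℝ) {ε : ℝ} (hε : 0 < ε) :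
    ∀ᶠ n : ℕ in atTop, ∀ C : Circuit ((⊤ : SimpleGraph (Fin n)).edgeSet),
      C.IsOver acBasis → C.acDepth ≤ d → (C.size : ℝ) ≤ c₀ * (n : ℝ) ^ (((k : ℝ) + 1) / 4) →
        plantFlipProb n k ((n : ℝ) ^ (-(2 : ℝ) / ((k : ℝ) - 1))) C.eval ≤ ε := by
  have hk1 : (1 : ℝ) < k := by exact_mod_cast hk
  have ht : (1 : ℝ) / 2 < ((k : ℝ) + 1) / 4 := by linarith
  have hα : (0 : ℝ) < 2 / ((k : ℝ) - 1) := div_pos two_pos (by linarith)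
  have hαt : 2 / ((k : ℝ) - 1) ≤ 1 / (2 * (((k : ℝ) + 1) / 4) - 1) := by
    rw [show 2 * (((k : ℝ) + 1) / 4) - 1 = ((k : ℝ) - 1) / 2 by ring, one_div_div]
  have := rossman2008_thm11_uniform h k d (((k : ℝ) + 1) / 4) (2 / ((k : ℝ) - 1)) c₀ ht hα hαt hε
  simpa only [neg_div] using this

end Literature.Computability.Complexity

end
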